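import Literature.AnabelianGeometry.SemiGraphs.PSCSeparatingCoveringsCrossVertex
import Literature.AnabelianGeometry.SemiGraphs.PSCTwoComponentPointedProp12
import HarnessLib

/-!
# [CombGC] Prop. 1.2, proof p. 9: VERTICIAL separating coverings at two-component data POINTED ON BOTH SIDES (row F-2826)

Mochizuki, *A combinatorial version of the Grothendieck conjecture*, Tohoku Math. J. **59** (2007)
[CombGC], PROOF of Proposition 1.2, author's manuscript p. 9: "if `v₁ ≠ v₂` …, then there exists a finite
étale … covering `G' → G` whose restriction to the anabelioid `G_{v₂}` … is trivial …, but whose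
restriction to the anabelioid `G_{v₁}` … is nontrivial" [cite: MochizukiCombGC2007, Prop 1.2 proof p.9];
typed LEVEL-WISE as `PSCDatum.VerticialSeparatingCoverings` (abc-iut-w4-d081, row P12-L01-V of
`SUBDAG-CombGC-Prop12.md`; abc-iut FACT-LIST row F-2826, the verticial conjunct of F-2829 / F-2830 —
a schema whose universal closure is refuted as typed; the instance forms at genuine carriers are the content).

PROOF-ONLY file (abc-iut-f-166 gen 6, row «ONE-CUSP-CORNERS» (1), file 1/3; 0 definitions).  The carrier:
the data of two-component shape POINTED ON BOTH SIDES of gen 2 (`PSCTwoComponentAffinePointedOrigin.lean`: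
`C₀ ∪_ν C₁`, `1 ≤ s ≤ r − 1` marked points on `C₁`, both components stable; `ι : Γ_{g,r} → Π` a profinite
pro-`Σ` completion) — so a component may carry a SINGLE marked point, the corner `min(s, r − s) = 1` that
the affine files (`s ≥ 2`, `r − s ≥ 2`: `verticialSeparatingCoverings_of_twoComponentAffine`) leave out.
There `Π_{v₀}` and `Π_{v₁}` are sub-basis closures of ONE node-loop basis `b′` of gen 3
(`exists_freeGroupBasis_nodeLoop`, `closure_firstSubsurface_eq_nodeLoopBasis`,
`closure_secondSubsurface_eq_nodeLoopBasis`, exactly as abc-iut-f-164's `PSCTwoComponentPointedProp12.lean`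
uses them), so the gen-3 engine `verticialSeparatingCoverings_of_freeFactors'` applies verbatim:

* `verticialSeparatingCoverings_of_twoComponentPointed` — **F-2826** (`V' := V`) at EVERY such datum:
  two level vertices over the same vertex are separated by the fibred twist, over different vertices by
  the projection killing the other factor; the surviving letter is a handle of the alive component or, if
  that component has genus `0`, its second marked point (stability).

Sequels (files 2/3, 3/3): `PSCSeparatingCoveringsTwoComponentPointedEdges.lean` (F-2827),
`PSCTwoComponentPointedProp12All.lean` (F-2829, Prop. 1.2 in full, origin rows F-2830 and non-vacuity).
Instance forms at data of the shape of genuine two-component curves: consistency evidence for the typed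
schema, not the printed theorem for all pointed stable curves (cell FOUNDATIONS rows 13–14).  Nothing
here takes a side on [IUTchIII] Cor. 3.12.
-/

noncomputable section

namespace Literature.AnabelianGeometry.SemiGraphs

namespace PSCDatum

open scoped Pointwise
open Literature.GroupTheory.CombinatorialGroupTheory
open Literature.GroupTheory.CombinatorialGroupTheory.PuncturedSurfaceGroup (a b c
  exists_freeGroupBasis_nodeLoop closure_firstSubsurface_eq_nodeLoopBasis closure_secondSubsurface_eq_nodeLoopBasis)
open Literature.GroupTheory.CombinatorialGroupTheory.FreeFactorFibredTwist (lift_apply_basis)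
open SemiGraphOfAnabelioids (IsProSigmaCompletion)

section Datum

variable {P : Type} [Group P] [TopologicalSpace P] [IsTopologicalGroup P]
variable [CompactSpace P] [TotallyDisconnectedSpace P] {Sigma : Set ℕ} {g r : ℕ}

/-! ### F-2826: the verticial separating coverings -/

/-- **Row P12-L01-V / F-2826 (`VerticialSeparatingCoverings`, `V' := V`) at EVERY two-component datum
pointed on both sides** (`1 ≤ s ≤ r − 1`, both components stable): `Π_{v₀} = cl ι⟨b′(S₀)⟩`,
`Π_{v₁} = cl ι⟨b′(T₁)⟩` for the node-loop basis `b′`; two level vertices over the same vertex are separated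
by the fibred twist, over different vertices by the projection killing the other factor — the surviving
letter being a handle of the alive component or, if that component has genus `0`, its second marked point.
[cite: MochizukiCombGC2007, Prop 1.2 proof p.9] -/
theorem verticialSeparatingCoverings_of_twoComponentPointed (hne : Sigma.Nonempty)
    (hprime : ∀ p ∈ Sigma, p.Prime) (ι : PuncturedSurfaceGroup g r →* P)
    (hι : IsProSigmaCompletion Sigma ι) (G : PSCDatum P) {g₀ s : ℕ} (hg₀ : g₀ ≤ g) (hs : 1 ≤ s)
    (hsr : s + 1 ≤ r) (hst₀ : 1 ≤ g₀ ∨ 2 ≤ r - s) (hst₁ : 1 ≤ g - g₀ ∨ 2 ≤ s)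
    (v₀ v₁ : G.graph.V) (hV : ∀ w, w = v₀ ∨ w = v₁) (ε : PuncturedSurfaceGroup g r)
    (hε : ε = ((List.finRange r).map fun j : Fin r =>
          if s ≤ (j : ℕ) then PuncturedSurfaceGroup.c (g := g) j else 1).prod *
        ((List.finRange g).map fun i : Fin g => if (i : ℕ) < g₀ then
          PuncturedSurfaceGroup.a (r := r) i * PuncturedSurfaceGroup.b i *
            (PuncturedSurfaceGroup.a i)⁻¹ * (PuncturedSurfaceGroup.b i)⁻¹ else 1).prod)
    (hV₀ : G.vertGp v₀ = ((Subgroup.closure {x : PuncturedSurfaceGroup g r |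
        (∃ i : Fin g, (i : ℕ) < g₀ ∧ (x = PuncturedSurfaceGroup.a i ∨ x = PuncturedSurfaceGroup.b i)) ∨
        ∃ j : Fin r, s ≤ (j : ℕ) ∧ x = PuncturedSurfaceGroup.c j}).map ι).topologicalClosure)
    (hV₁ : G.vertGp v₁ = ((Subgroup.closure {x : PuncturedSurfaceGroup g r |
        (∃ i : Fin g, g₀ ≤ (i : ℕ) ∧ (x = PuncturedSurfaceGroup.a i ∨ x = PuncturedSurfaceGroup.b i)) ∨
        (∃ j : Fin r, (j : ℕ) < s ∧ x = PuncturedSurfaceGroup.c j) ∨ x = ε}).map ι).topologicalClosure) :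
    G.VerticialSeparatingCoverings := by
  classical
  obtain ⟨r', rfl⟩ : ∃ r', r = r' + 1 := ⟨r - 1, by omega⟩
  have hSig : ∃ ℓ ∈ Sigma, ℓ.Prime := by
    obtain ⟨ℓ, hℓ⟩ := hne
    exact ⟨ℓ, hℓ, hprime ℓ hℓ⟩
  -- the node-loop basis
  obtain ⟨b', ha', hb', hc', hk'⟩ := exists_freeGroupBasis_nodeLoop g r' g₀ s (by omega) (by omega) ε hε
  have hk : ∀ h : s - 1 < r', b' (Sum.inr ⟨s - 1, h⟩) = ε := fun _ => hk'
  -- the index sets of the two factors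
  set S₀ : Set ((Fin g × Bool) ⊕ Fin r') :=
    {x | Sum.elim (fun p : Fin g × Bool => (p.1 : ℕ) < g₀) (fun j : Fin r' => s ≤ (j : ℕ) + 1) x} with hS₀
  set T₁ : Set ((Fin g × Bool) ⊕ Fin r') :=
    {x | Sum.elim (fun p : Fin g × Bool => g₀ ≤ (p.1 : ℕ)) (fun j : Fin r' => (j : ℕ) + 1 ≤ s) x} with hT₁
  have hSl : ∀ p : Fin g × Bool, (Sum.inl p : (Fin g × Bool) ⊕ Fin r') ∈ S₀ ↔ (p.1 : ℕ) < g₀ :=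
    fun _ => Iff.rfl
  have hSr : ∀ j : Fin r', (Sum.inr j : (Fin g × Bool) ⊕ Fin r') ∈ S₀ ↔ s ≤ (j : ℕ) + 1 := fun _ => Iff.rfl
  have hTl : ∀ p : Fin g × Bool, (Sum.inl p : (Fin g × Bool) ⊕ Fin r') ∈ T₁ ↔ g₀ ≤ (p.1 : ℕ) :=
    fun _ => Iff.rfl
  have hTr : ∀ j : Fin r', (Sum.inr j : (Fin g × Bool) ⊕ Fin r') ∈ T₁ ↔ (j : ℕ) + 1 ≤ s := fun _ => Iff.rfl
  -- the two vertex groups as sub-basis closures of `b'`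
  have hA₀ : G.vertGp v₀ = ((Subgroup.closure (b' '' S₀)).map ι).topologicalClosure := by
    rw [hV₀, closure_firstSubsurface_eq_nodeLoopBasis hε ha' hb' hc' hk (by omega) (by omega)]
  have hA₁ : G.vertGp v₁ = ((Subgroup.closure (b' '' T₁)).map ι).topologicalClosure := by
    rw [hV₁, closure_secondSubsurface_eq_nodeLoopBasis hε ha' hb' hc' hk (by omega) (by omega)]
  -- a letter of `S₀ ∖ T₁` and one of `T₁ ∖ S₀` (stability of `C₀`, resp. `C₁`)
  obtain ⟨x₀, hx₀S, hx₀T⟩ : ∃ x, x ∈ S₀ ∧ x ∉ T₁ := by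
    rcases hst₀ with h | h
    · exact ⟨Sum.inl (⟨0, by omega⟩, false), (hSl _).mpr (by simp only; omega),
        fun h' => by have := (hTl _).mp h'; simp only at this; omega⟩
    · exact ⟨Sum.inr ⟨s, by omega⟩, (hSr _).mpr (by simp only; omega),
        fun h' => by have := (hTr _).mp h'; simp only at this; omega⟩
  obtain ⟨x₁, hx₁T, hx₁S⟩ : ∃ x, x ∈ T₁ ∧ x ∉ S₀ := by
    rcases hst₁ with h | h
    · exact ⟨Sum.inl (⟨g₀, by omega⟩, false), (hTl _).mpr (by simp only; exact le_rfl),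
        fun h' => by have := (hSl _).mp h'; simp only at this; omega⟩
    · exact ⟨Sum.inr ⟨0, by omega⟩, (hTr _).mpr (by simp only; omega),
        fun h' => by have := (hSr _).mp h'; simp only at this; omega⟩
  -- the data for `verticialSeparatingCoverings_of_freeFactors'`
  let bs : G.graph.V → FreeGroupBasis ((Fin g × Bool) ⊕ Fin r') (PuncturedSurfaceGroup g (r' + 1)) :=
    fun _ => b'
  let Ss : G.graph.V → Set ((Fin g × Bool) ⊕ Fin r') := fun v => if v = v₀ then S₀ else T₁
  have hSs₀ : Ss v₀ = S₀ := if_pos rfl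
  have hSs₁ : ∀ {v}, v ≠ v₀ → Ss v = T₁ := fun h => if_neg h
  have hSs : ∀ v, (Ss v).Nonempty := by
    intro v
    by_cases h : v = v₀
    · subst h
      rw [hSs₀]
      exact ⟨x₀, hx₀S⟩
    · rw [hSs₁ h]
      exact ⟨x₁, hx₁T⟩
  have hv : ∀ v, G.vertGp v = ((Subgroup.closure (bs v '' Ss v)).map ι).topologicalClosure := by
    intro v
    by_cases h : v = v₀
    · subst h
      rw [hSs₀]
      exact hA₀
    · rcases hV v with h' | h'
      · exact absurd h' h
      · subst h'
        rw [hSs₁ h]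
        exact hA₁
  let ρs : G.graph.V → (PuncturedSurfaceGroup g (r' + 1) →* PuncturedSurfaceGroup g (r' + 1)) :=
    fun v => b'.lift fun x => if x ∈ Ss v then 1 else b' x
  have hρs : ∀ v x, ρs v (bs v x) = if x ∈ Ss v then 1 else bs v x := fun v x =>
    lift_apply_basis b' _ x
  have hmem : ∀ (S : Set ((Fin g × Bool) ⊕ Fin r')) (x : (Fin g × Bool) ⊕ Fin r'), x ∈ S →
      ι (b' x) ∈ ((Subgroup.closure (b' '' S)).map ι).topologicalClosure := fun S x hx =>
    Subgroup.le_topologicalClosure _ (Subgroup.mem_map_of_mem ι (Subgroup.subset_closure ⟨x, hx, rfl⟩))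
  -- cross-vertex separation: the surviving letters `x₀`, `x₁`
  have hsep : ∀ w₁ w₂ : G.graph.V, w₁ ≠ w₂ → ∃ x, ι x ∈ G.vertGp w₁ ∧ ρs w₂ x ≠ 1 := by
    intro w₁ w₂ hne12
    by_cases h2 : w₂ = v₀
    · subst h2
      refine ⟨b' x₁, ?_, ?_⟩
      · rw [hv w₁, hSs₁ hne12]
        exact hmem T₁ x₁ hx₁T
      · rw [show b' x₁ = bs w₂ x₁ from rfl, hρs, hSs₀, if_neg hx₁S]
        exact FreeGroupBasis.apply_ne_one _ _
    · have h1 : w₁ = v₀ := by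
        rcases hV w₁ with h | h
        · exact h
        · rcases hV w₂ with h' | h'
          · exact absurd h' h2
          · exact absurd (h.trans h'.symm) hne12
      subst h1
      refine ⟨b' x₀, ?_, ?_⟩
      · rw [hA₀]
        exact hmem S₀ x₀ hx₀S
      · rw [show b' x₀ = bs w₂ x₀ from rfl, hρs, hSs₁ h2, if_neg hx₀T]
        exact FreeGroupBasis.apply_ne_one _ _
  exact G.verticialSeparatingCoverings_of_freeFactors' hι hSig bs Ss hSs hv ρs hρs hsep

end Datum

end PSCDatum

end Literature.AnabelianGeometry.SemiGraphs

end
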